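import Mathlib.Algebra.MvPolynomial.CommRing
import Mathlib.RingTheory.MvPolynomial.Ideal
import Mathlib.Data.Finsupp.Weight
import Mathlib.Tactic
import HarnessLib

/-!
# KILL TEST K3.4 (cell res-hironaka, rung L, slot W3.4, L-G3 datum Ě) — file F2a: the AXIS-ESCAPE witness re-typed in
# EVERY ambient dimension (exponent bookkeeping in `R[X_i : i ∈ σ]` with a distinguished axis variable `z`)

[OURS · L1 W3.4 / kill test K3.4] — folklore polynomial algebra; replaces the role of NO printed item and is NOT a
statement of H. Hironaka's manuscript (2017-03-23) [claim: Hironaka2017, status: under-review], which is named only to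
say which question the bookkeeping bears on (RESCUE-SEED L-G3 W3.4: «does AxisEscape's witness escape the
AR-equivalence class or only the literal exponent?»). AI review is weaker than expert review.

The prior index module `Literature.AlgebraicGeometry.Hironaka2017.AxisEscape` proves the escape in THREE variables
(`MvPolynomial (Fin 3) R`, z-chart `x ↦ xz, y ↦ yz, z ↦ z`). Moving inside an AR-class changes the ambient: an
ambient REDUCTION `F ⇁_Y G` (Th. 3.10) carries the focus to a smooth `Y` containing the germ of the z-axis `L`, with
fewer coordinates — e.g. the maximal-contact plane `{y = 0} ≅ 𝔸²_{x,z}` of `Ê = (y² − x²z² + x⁵, 2)` — and an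
AR-EXTENSION (Lem. 3.14 / Lem. 15.3) or the `t`-variables of Def. 2.5 add coordinates. This file proves the escape and
the accumulation lemma for `MvPolynomial σ R` over ANY commutative ring `R` and ANY index type `σ` with a chosen axis
variable `z : σ`, so that every LITERAL representative on every such ambient is covered:

* `axisWt z e = Σ_{i ≠ z} e i` (order of the monomial `X^e` along the axis `L = V(X_i : i ≠ z)`), the exponent chart
  `shift z e = e + (axisWt z e)·𝟙_z` of the z-chart `zChart z : X_i ↦ X_i X_z (i ≠ z), X_z ↦ X_z`
  (`zChart_monomial`), its injectivity (NO CANCELLATION: `mem_support_zChart`), the tower `zIter z k = (zChart z)^k`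
  and `mem_support_zIter`;
* `TowerPermissible z g b m := ∀ k ≤ m, zIter z k g ∈ 𝔪^{(k+1)b}` (`𝔪 = MvPolynomial.idealOfVars`): «the origins
  `R_0 = O, R_1, …, R_m` of the successive z-charts lie in `Sing` of the successive transforms of `(g, b)`» (FAITHFUL:
  file F2b, `X_pow_dvd_zIter_of_towerPermissible`);
* ESCAPE `not_towerPermissible_of_mem_support`: a monomial `X^e` of `g` with `axisWt z e < b` forces
  `¬ TowerPermissible z g b (e z)`; ACCUMULATION `mem_axisIdeal_pow_of_forall_towerPermissible`: persistence for all `m`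
  forces `g ∈ (X_i : i ≠ z)^b`, i.e. the whole axis lies in `Sing((g, b))`; ideal-level forms
  `le_axisIdeal_pow_of_forall_towerPermissible` / `exists_escape_of_not_le_axisIdeal_pow`.

File F2b (`MarkedTransferCampaignW34AxisEscapeInstances`) adds faithfulness, the DICTIONARY to the prior Fin-3 module
(the prior witness is literally the `σ = Fin 3`, `z = 2` instance) and the maximal-contact plane instance. Read with
file F1 (`MarkedTransferCampaignW34ClassTransport`: 𝔖-membership of the fixed tower LSB is transported exactly along
`∼`, `⇌_Y`, `⇁_Y`): whichever representative of the AR- or LSB-class of a focus `P` with isolated singular point on the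
axis is chosen, on whichever smooth ambient through the axis, it is a literal pair `(A, b)` some member of which has a
monomial of axis weight `< b`, and the tower escapes it. The ONE non-kernel link, common to all G3 rows of the cell
(ledger/group-3/DOSSIER.md §0.4), is the reading «`TowerPermissible` = scheme-level 𝔖-membership of the tower LSB on
`𝔸ⁿ`»; it is named, not claimed.

## References
* H. Hironaka, ms. 2017-03-23 — Def. 2.1 p.5 (transform), §2.1 p.4 l.35–39 (`Sing(E)`), Th. 3.10 p.10, Def. 3.12 p.11,
  Lem. 3.14 p.12, Eqs. (43)/(44) p.30, p.86 l.19–36, §16.3 p.87 (scope only; ADJUDICATED, never a premise). [Hironaka2017]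
* cell res-hironaka: plan/RESCUE-SEED.md §1 L-G3 W3.4; papers/…/hironaka-charp/REPAIR-CENSUS.md §J (B-iv)‴ (INDEX ONLY).
-/

noncomputable section

namespace Summit.ResolutionOfSingularities.ResolutionOfSingularities.Theorems.CampaignW34

set_option linter.dupNamespace false -- mandated namespace of this single-conjunct summit

open MvPolynomial

variable {R : Type*} [CommRing R] {σ : Type*}

/-! ## The off-axis weight and the exponent chart -/

/-- [OURS · K3.4] The AXIS WEIGHT of an exponent: `axisWt z e = Σ_{i ≠ z} e i = degree (e.erase z)` — the order of the
monomial `X^e` along the axis `L = V(X_i : i ≠ z)` (in three variables `(i,j,l) ↦ i + j`, the prior `wxy`). [folklore] -/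
def axisWt (z : σ) : (σ →₀ ℕ) →+ ℕ := Finsupp.degree.comp (Finsupp.eraseAddHom z)

/-- [OURS · K3.4] `axisWt z e = (e.erase z).degree`. [folklore] -/
theorem axisWt_apply (z : σ) (e : σ →₀ ℕ) : axisWt z e = (e.erase z).degree := rfl

/-- [OURS · K3.4] `degree e = e z + axisWt z e`. [folklore] -/
theorem degree_eq_add_axisWt (z : σ) (e : σ →₀ ℕ) : e.degree = e z + axisWt z e := by
  conv_lhs => rw [← Finsupp.single_add_erase z e]
  rw [map_add, Finsupp.degree_single, axisWt_apply]

/-- [OURS · K3.4] The axis variable has axis weight `0`. [folklore] -/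
@[simp] theorem axisWt_single_self (z : σ) (k : ℕ) : axisWt z (Finsupp.single z k) = 0 := by
  simp [axisWt_apply]

/-- [OURS · K3.4] A transversal variable `X_i`, `i ≠ z`, has axis weight equal to its exponent. [folklore] -/
theorem axisWt_single_ne (z : σ) {i : σ} (h : i ≠ z) (k : ℕ) : axisWt z (Finsupp.single i k) = k := by
  rw [axisWt_apply, Finsupp.erase_single_ne h.symm, Finsupp.degree_single]

/-- [OURS · K3.4] The z-CHART ON EXPONENTS, `shift z e = e + (axisWt z e)·𝟙_z`: the exponent of the image of `X^e`
under `X_i ↦ X_i X_z (i ≠ z)`, `X_z ↦ X_z` (three variables: `(i,j,l) ↦ (i,j,l+i+j)`, the prior `shift`). An additive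
map. [folklore] -/
def shift (z : σ) : (σ →₀ ℕ) →+ (σ →₀ ℕ) :=
  AddMonoidHom.id _ + (Finsupp.singleAddHom z).comp (axisWt z)

/-- [OURS · K3.4] `shift z e = e + single z (axisWt z e)`. [folklore] -/
theorem shift_apply (z : σ) (e : σ →₀ ℕ) : shift z e = e + Finsupp.single z (axisWt z e) := rfl

/-- [OURS · K3.4] `shift` keeps the transversal exponents. [folklore] -/
theorem shift_apply_ne (z : σ) {i : σ} (h : i ≠ z) (e : σ →₀ ℕ) : shift z e i = e i := by
  classical
  simp [shift_apply, h.symm]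

/-- [OURS · K3.4] `shift` raises the axis exponent by the axis weight: `(shift z e) z = e z + axisWt z e = degree e`.
[folklore] -/
theorem shift_apply_self (z : σ) (e : σ →₀ ℕ) : shift z e z = e z + axisWt z e := by
  simp [shift_apply]

/-- [OURS · K3.4] `shift` does not change the axis weight. [folklore] -/
theorem axisWt_shift (z : σ) (e : σ →₀ ℕ) : axisWt z (shift z e) = axisWt z e := by
  rw [shift_apply, map_add, axisWt_single_self, add_zero]

/-- [OURS · K3.4] Degree after one z-chart: `degree (shift z e) = degree e + axisWt z e`. [folklore] -/
theorem degree_shift (z : σ) (e : σ →₀ ℕ) : (shift z e).degree = e.degree + axisWt z e := by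
  rw [shift_apply, map_add, Finsupp.degree_single]

/-- [OURS · K3.4] The z-chart is INJECTIVE on exponents (no two monomials collide: no cancellation). [folklore] -/
theorem shift_injective (z : σ) : Function.Injective (shift z) := by
  intro e e' h
  have hw : axisWt z e = axisWt z e' := by rw [← axisWt_shift z e, h, axisWt_shift]
  have h2 : e + Finsupp.single z (axisWt z e) = e' + Finsupp.single z (axisWt z e) := by
    conv_rhs => rw [hw]
    exact h
  exact add_right_cancel h2

/-- [OURS · K3.4] `k` z-charts on exponents: `shiftN z k e = e + (k · axisWt z e)·𝟙_z`. [folklore] -/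
def shiftN (z : σ) (k : ℕ) (e : σ →₀ ℕ) : σ →₀ ℕ := e + Finsupp.single z (k * axisWt z e)

/-- [OURS · K3.4] `shiftN z 0 = id`. [folklore] -/
@[simp] theorem shiftN_zero (z : σ) (e : σ →₀ ℕ) : shiftN z 0 e = e := by simp [shiftN]

/-- [OURS · K3.4] `shiftN` does not change the axis weight. [folklore] -/
theorem axisWt_shiftN (z : σ) (k : ℕ) (e : σ →₀ ℕ) : axisWt z (shiftN z k e) = axisWt z e := by
  rw [shiftN, map_add, axisWt_single_self, add_zero]

/-- [OURS · K3.4] One more z-chart: `shift z (shiftN z k e) = shiftN z (k+1) e`. [folklore] -/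
theorem shift_shiftN (z : σ) (k : ℕ) (e : σ →₀ ℕ) : shift z (shiftN z k e) = shiftN z (k + 1) e := by
  rw [shift_apply, axisWt_shiftN, shiftN, shiftN, add_assoc, ← Finsupp.single_add, add_mul, one_mul]

/-- [OURS · K3.4] Degree after `k` z-charts: `degree (shiftN z k e) = degree e + k · axisWt z e`. [folklore] -/
theorem degree_shiftN (z : σ) (k : ℕ) (e : σ →₀ ℕ) : (shiftN z k e).degree = e.degree + k * axisWt z e := by
  rw [shiftN, map_add, Finsupp.degree_single]

/-! ## The z-chart as a ring endomorphism; supports are carried bijectively -/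

/-- [OURS · K3.4] The z-CHART of the blow-up of the origin of `𝔸^σ = Spec R[X_i : i ∈ σ]`, as an `R`-algebra
endomorphism: `X_i ↦ X_i · X_z` for `i ≠ z`, `X_z ↦ X_z` (the chart containing the direction of the axis
`L = V(X_i : i ≠ z)`; its origin is the infinitely near point of `L`). Total transform of `g` = `zChart z g`. [folklore] -/
def zChart (z : σ) : MvPolynomial σ R →ₐ[R] MvPolynomial σ R := by
  classical exact aeval fun i => if i = z then X z else X i * X z

/-- [OURS · K3.4] `zChart z X_z = X_z`. [folklore] -/
@[simp] theorem zChart_X_self (z : σ) : zChart z (X z : MvPolynomial σ R) = X z := by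
  classical
  simp [zChart]

/-- [OURS · K3.4] `zChart z X_i = X_i X_z` for `i ≠ z`. [folklore] -/
theorem zChart_X_ne (z : σ) {i : σ} (h : i ≠ z) : zChart z (X i : MvPolynomial σ R) = X i * X z := by
  classical
  simp [zChart, h]

/-- [OURS · K3.4] THE CHART ACTS DIAGONALLY ON MONOMIALS: `zChart z (c X^e) = c X^{shift z e}`. [folklore] -/
theorem zChart_monomial (z : σ) (e : σ →₀ ℕ) (c : R) :
    zChart z (monomial e c) = monomial (shift z e) c := by
  classical
  induction e using Finsupp.induction with
  | zero => simp [zChart, shift_apply]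
  | single_add i k f _ _ ih =>
    rw [monomial_single_add, map_mul, map_pow, ih, map_add,
      ← one_mul c, ← monomial_mul, one_mul]
    congr 1
    by_cases hi : i = z
    · subst hi
      rw [zChart_X_self, shift_apply, axisWt_single_self, Finsupp.single_zero, add_zero, X_pow_eq_monomial]
    · rw [zChart_X_ne z hi, mul_pow, X_pow_eq_monomial, X_pow_eq_monomial, monomial_mul, one_mul, shift_apply,
        axisWt_single_ne z hi]

/-- [OURS · K3.4] The chart on the monomial expansion. [folklore] -/
theorem zChart_eq_sum (z : σ) (g : MvPolynomial σ R) :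
    zChart z g = ∑ e ∈ g.support, monomial (shift z e) (coeff e g) := by
  conv_lhs => rw [g.as_sum, map_sum]
  exact Finset.sum_congr rfl fun e _ => zChart_monomial z e _

/-- [OURS · K3.4] Coefficients are carried along the chart. [folklore] -/
theorem coeff_shift_zChart (z : σ) (g : MvPolynomial σ R) (e : σ →₀ ℕ) :
    coeff (shift z e) (zChart z g) = coeff e g := by
  classical
  rw [zChart_eq_sum, coeff_sum]
  simp only [coeff_monomial]
  rw [Finset.sum_eq_single e]
  · simp
  · intro b _ hb
    rw [if_neg]
    exact fun h => hb (shift_injective z h)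
  · intro he
    simp [notMem_support_iff.mp he]

/-- [OURS · K3.4] Exponents outside the image of the chart carry coefficient `0`. [folklore] -/
theorem coeff_zChart_eq_zero (z : σ) (g : MvPolynomial σ R) (e' : σ →₀ ℕ) (h : ∀ e, shift z e ≠ e') :
    coeff e' (zChart z g) = 0 := by
  classical
  rw [zChart_eq_sum, coeff_sum]
  exact Finset.sum_eq_zero fun b _ => by simp [coeff_monomial, h b]

/-- [OURS · K3.4] NO CANCELLATION: the support of `zChart z g` is exactly the image of the support of `g`. [folklore] -/
theorem mem_support_zChart (z : σ) (g : MvPolynomial σ R) (e' : σ →₀ ℕ) :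
    e' ∈ (zChart z g).support ↔ ∃ e ∈ g.support, shift z e = e' := by
  constructor
  · intro h'
    by_cases hex : ∃ e, shift z e = e'
    · obtain ⟨e, rfl⟩ := hex
      refine ⟨e, ?_, rfl⟩
      rw [mem_support_iff, coeff_shift_zChart] at h'
      exact mem_support_iff.mpr h'
    · exact absurd (coeff_zChart_eq_zero z g e' (not_exists.mp hex)) (mem_support_iff.mp h')
  · rintro ⟨e, he, rfl⟩
    rw [mem_support_iff, coeff_shift_zChart]
    exact mem_support_iff.mp he

/-! ## The tower of z-charts -/

/-- [OURS · K3.4] `zIter z k g = (zChart z)^k g`: the total transform of `g` after blowing up `O = R_0, R_1, …, R_{k−1}`,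
the origins of the successive z-charts (the infinitely near points of the axis `L`). [folklore] -/
def zIter (z : σ) (k : ℕ) (g : MvPolynomial σ R) : MvPolynomial σ R := (⇑(zChart (R := R) z))^[k] g

/-- [OURS · K3.4] `zIter z 0 = id`. [folklore] -/
@[simp] theorem zIter_zero (z : σ) (g : MvPolynomial σ R) : zIter z 0 g = g := rfl

/-- [OURS · K3.4] `zIter z (k+1) = zChart z ∘ zIter z k`. [folklore] -/
theorem zIter_succ (z : σ) (k : ℕ) (g : MvPolynomial σ R) : zIter z (k + 1) g = zChart z (zIter z k g) := by
  simp only [zIter, Function.iterate_succ_apply']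

/-- [OURS · K3.4] A monomial of `g` survives, with the same coefficient position, in every `zIter z k g`. [folklore] -/
theorem mem_support_zIter (z : σ) (k : ℕ) (g : MvPolynomial σ R) {e : σ →₀ ℕ} (he : e ∈ g.support) :
    shiftN z k e ∈ (zIter z k g).support := by
  induction k with
  | zero => simpa using he
  | succ k ih =>
    rw [zIter_succ, mem_support_zChart]
    exact ⟨shiftN z k e, ih, shift_shiftN z k e⟩

/-! ## The axis ideal `(X_i : i ≠ z)` and its powers, by supports -/

/-- [OURS · K3.4] The ideal of the axis `L`: `axisIdeal z = (X_i : i ≠ z)` (three variables: the prior `P = (x, y)`).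
[folklore] -/
def axisIdeal (z : σ) : Ideal (MvPolynomial σ R) := Ideal.span ((fun i => X i) '' {i | i ≠ z})

/-- [OURS · K3.4] The polynomials all of whose exponents have axis weight `≥ a`. [folklore] -/
def axisWtIdeal (z : σ) (a : ℕ) : Ideal (MvPolynomial σ R) :=
  restrictSupportIdeal R {e : σ →₀ ℕ | a ≤ axisWt z e} (by
    intro e e' hle he
    obtain ⟨d, rfl⟩ := le_iff_exists_add.mp hle
    simp only [Set.mem_setOf_eq, map_add] at he ⊢
    omega)

/-- [OURS · K3.4] Membership in `axisWtIdeal` is a condition on the support. [folklore] -/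
theorem mem_axisWtIdeal (z : σ) (a : ℕ) (g : MvPolynomial σ R) :
    g ∈ axisWtIdeal z a ↔ ∀ e ∈ g.support, a ≤ axisWt z e := by
  simp [axisWtIdeal, restrictSupportIdeal, mem_restrictSupport_iff, Set.subset_def]

/-- [OURS · K3.4] `axisWtIdeal` is multiplicative: `W_a · W_b ⊆ W_{a+b}`. [folklore] -/
theorem axisWtIdeal_mul_le (z : σ) (a b : ℕ) :
    axisWtIdeal (R := R) z a * axisWtIdeal z b ≤ axisWtIdeal z (a + b) := by
  classical
  refine Ideal.mul_le.mpr fun p hp q hq => (mem_axisWtIdeal z _ _).mpr fun e he => ?_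
  obtain ⟨e₁, he₁, e₂, he₂, rfl⟩ := Finset.mem_add.mp (support_mul p q he)
  have h₁ := (mem_axisWtIdeal z a p).mp hp e₁ he₁
  have h₂ := (mem_axisWtIdeal z b q).mp hq e₂ he₂
  simp only [map_add]
  omega

/-- [OURS · K3.4] `(X_i : i ≠ z)^b ⊆ W_b`: every exponent of an element of the `b`-th power of the axis ideal has axis
weight `≥ b`. [folklore] -/
theorem axisIdeal_pow_le (z : σ) (b : ℕ) : axisIdeal (R := R) z ^ b ≤ axisWtIdeal z b := by
  induction b with
  | zero =>
    intro g _
    exact (mem_axisWtIdeal z 0 g).mpr fun _ _ => Nat.zero_le _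
  | succ b ih =>
    rw [pow_succ]
    refine le_trans (Ideal.mul_mono ih ?_) (axisWtIdeal_mul_le z b 1)
    refine Ideal.span_le.mpr ?_
    rintro _ ⟨i, hi, rfl⟩
    refine (mem_axisWtIdeal z 1 _).mpr fun e he => ?_
    have hsub : (X i : MvPolynomial σ R).support ⊆ {Finsupp.single i 1} := support_monomial_subset
    have : e = Finsupp.single i 1 := by simpa using hsub he
    subst this
    rw [axisWt_single_ne z hi]

/-- [OURS · K3.4] A monic monomial with no axis variable lies in `(X_i : i ≠ z)^{degree}`. [folklore] -/
theorem monomial_mem_axisIdeal_pow (z : σ) {f : σ →₀ ℕ} (hf : f z = 0) :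
    (monomial f (1 : R)) ∈ axisIdeal (R := R) z ^ f.degree := by
  classical
  induction f using Finsupp.induction with
  | zero => simp
  | single_add i k f hi hk ih =>
    have hiz : i ≠ z := by
      rintro rfl
      simp [Finsupp.notMem_support_iff.mp hi] at hf
      exact hk hf
    have hfz : f z = 0 := by
      have := hf
      rw [Finsupp.add_apply, Finsupp.single_apply, if_neg hiz, zero_add] at this
      exact this
    rw [monomial_single_add, map_add, Finsupp.degree_single, pow_add]
    refine Ideal.mul_mem_mul ?_ (ih hfz)
    have hXi : (X i : MvPolynomial σ R) ∈ axisIdeal (R := R) z := Ideal.subset_span ⟨i, hiz, rfl⟩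
    exact Ideal.pow_mem_pow hXi k

/-- [OURS · K3.4] Conversely `W_b ⊆ (X_i : i ≠ z)^b`: axis weight `≥ b` on the support puts `g` in the `b`-th power of
the axis ideal. [folklore] -/
theorem mem_axisIdeal_pow_of_axisWt_le (z : σ) {g : MvPolynomial σ R} {b : ℕ}
    (h : ∀ e ∈ g.support, b ≤ axisWt z e) : g ∈ axisIdeal (R := R) z ^ b := by
  rw [g.as_sum]
  refine Ideal.sum_mem _ fun e he => ?_
  have hsplit : monomial e (coeff e g) =
      monomial (Finsupp.single z (e z)) (coeff e g) * monomial (e.erase z) (1 : R) := by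
    rw [monomial_mul, mul_one, Finsupp.single_add_erase]
  rw [hsplit]
  refine Ideal.mul_mem_left _ _ (Ideal.pow_le_pow_right (h e he) ?_)
  have := monomial_mem_axisIdeal_pow (R := R) z (f := e.erase z) (by simp)
  rwa [← axisWt_apply] at this

/-- [OURS · K3.4] `g ∈ (X_i : i ≠ z)^b ↔` every exponent of `g` has axis weight `≥ b` (the axis `L` lies in
`Sing((g, b))` iff …). [folklore] -/
theorem mem_axisIdeal_pow_iff (z : σ) (g : MvPolynomial σ R) (b : ℕ) :
    g ∈ axisIdeal (R := R) z ^ b ↔ ∀ e ∈ g.support, b ≤ axisWt z e :=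
  ⟨fun hg => (mem_axisWtIdeal z b g).mp (axisIdeal_pow_le z b hg), mem_axisIdeal_pow_of_axisWt_le z⟩

/-! ## Tower permissibility, escape and accumulation -/

/-- [OURS · K3.4] `R_k ∈ Sing((g,b)^{(k)})` for all `k ≤ m`, i.e. the tower `s_m = [O; R_1; …; R_m]` of z-chart origins is
`(g,b)`-permissible: the `k`-th total transform lies in `𝔪^{(k+1)b}` (`𝔪 = (X_i : i ∈ σ) = MvPolynomial.idealOfVars`).
Faithful by `X_pow_dvd_zIter_of_towerPermissible` (file F2b). Three variables: the prior `AxisEscape.TowerPermissible`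
(`towerPermissible_fin_three_iff`, file F2b). [folklore] -/
def TowerPermissible (z : σ) (g : MvPolynomial σ R) (b m : ℕ) : Prop :=
  ∀ k ≤ m, zIter z k g ∈ idealOfVars σ R ^ ((k + 1) * b)

/-- [OURS · K3.4] AXIS ESCAPE IN EVERY AMBIENT DIMENSION. If `g` has a monomial `X^e` with axis weight
`axisWt z e < b` (the axis is NOT in `Sing((g,b))` through this monomial), then the tower is not `(g,b)`-permissible
up to step `e z`: some `R_k`, `k ≤ e z`, is not in `Sing` of the `k`-th transform. (The surviving monomial has degree
`degree e + (e z)·axisWt z e = (e z + 1)·axisWt z e + e z < (e z + 1)·b` after `e z` charts.) [folklore] -/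
theorem not_towerPermissible_of_mem_support (z : σ) {g : MvPolynomial σ R} {b : ℕ} {e : σ →₀ ℕ}
    (he : e ∈ g.support) (hb : axisWt z e < b) : ¬ TowerPermissible z g b (e z) := by
  intro hT
  have hmem := hT (e z) le_rfl
  have hsupp : shiftN z (e z) e ∈ (zIter z (e z) g).support := mem_support_zIter z _ _ he
  have hdeg := (mem_pow_idealOfVars_iff _ _).mp hmem _ hsupp
  rw [degree_shiftN, degree_eq_add_axisWt z e] at hdeg
  have key : (e z + 1) * (axisWt z e + 1) ≤ (e z + 1) * b := Nat.mul_le_mul_left _ hb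
  nlinarith [key, hdeg]

/-- [OURS · K3.4] Quantitative form: permissibility up to step `m` forces axis weight `≥ b` on every monomial whose axis
exponent is `≤ m`. [folklore] -/
theorem axisWt_le_of_towerPermissible (z : σ) {g : MvPolynomial σ R} {b m : ℕ} (h : TowerPermissible z g b m) :
    ∀ e ∈ g.support, e z ≤ m → b ≤ axisWt z e := by
  intro e he hl
  by_contra hlt
  exact not_towerPermissible_of_mem_support z he (not_le.mp hlt) fun k hk => h k (le_trans hk hl)

/-- [OURS · K3.4] ACCUMULATION IN EVERY AMBIENT DIMENSION. If every tower `s_m` is `(g,b)`-permissible then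
`g ∈ (X_i : i ≠ z)^b`: the whole axis `L` lies in `Sing((g,b))`. Read for a literal pair `P = (A, b)` whose singular
locus near `O` is `{O}` (the `Invmax`-point of the witness): the tower leaves `Sing` of the transforms of `P` after
finitely many steps. [folklore] -/
theorem mem_axisIdeal_pow_of_forall_towerPermissible (z : σ) {g : MvPolynomial σ R} {b : ℕ}
    (h : ∀ m, TowerPermissible z g b m) : g ∈ axisIdeal (R := R) z ^ b :=
  mem_axisIdeal_pow_of_axisWt_le z fun _ he =>
    not_lt.mp fun hlt => not_towerPermissible_of_mem_support z he hlt (h _)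

/-- [OURS · K3.4] Ideal-level accumulation: if every element of an ideal `A` keeps the tower permissible for ever (with
exponent `b`), then `A ⊆ (X_i : i ≠ z)^b` — the axis lies in `Sing((A, b))`. [folklore] -/
theorem le_axisIdeal_pow_of_forall_towerPermissible (z : σ) {A : Ideal (MvPolynomial σ R)} {b : ℕ}
    (h : ∀ g ∈ A, ∀ m, TowerPermissible z g b m) : A ≤ axisIdeal (R := R) z ^ b :=
  fun g hg => mem_axisIdeal_pow_of_forall_towerPermissible z (h g hg)

/-- [OURS · K3.4] Ideal-level escape: a literal pair `(A, b)` with `A ⊄ (X_i : i ≠ z)^b` (the axis is not in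
`Sing((A,b))` — e.g. `Sing((A,b)) = {O}`) owns an element and a step at which the tower stops being permissible.
[folklore] -/
theorem exists_escape_of_not_le_axisIdeal_pow (z : σ) {A : Ideal (MvPolynomial σ R)} {b : ℕ}
    (h : ¬ A ≤ axisIdeal (R := R) z ^ b) : ∃ g ∈ A, ∃ m, ¬ TowerPermissible z g b m := by
  by_contra hcon
  refine h (le_axisIdeal_pow_of_forall_towerPermissible z fun g hg m => ?_)
  by_contra hm
  exact hcon ⟨g, hg, m, hm⟩

end Summit.ResolutionOfSingularities.ResolutionOfSingularities.Theorems.CampaignW34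

end
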